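import Literature.Computability.Complexity.HashBricks
import Literature.Computability.Complexity.StockmeyerEstimator
import Literature.Computability.Complexity.TruthTableFunctions
import Literature.Computability.Complexity.CookReducibilityTransitive
import Literature.Computability.Complexity.ApproximateCounting
import HarnessLib

/-!
# Stockmeyer's approximate counting theorem, relativised: the machines (discharge of `stockmeyerApproxCounting`)

Trunk `CplxCore`. This file proves the named fact `stockmeyerApproxCounting` of
`ApproximateCounting.lean` — Aaronson–Arkhipov, *The computational complexity of linear optics*,
Theory of Computing 9 (2013), Thm. 4.1 (p. 175), after Stockmeyer (1985): for every oracle `O` and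
every relation `R ∈ P^O` there are `L ∈ NP^O`, `F ∈ FP^L` and a polynomial coin budget `c` such that
on `⟨x, 1^m, 1^{kη}, 1^{kδ}, u⟩` the number read off `F`'s answer approximates
`# = #{y ∈ {0,1}^m | ⟨x, y⟩ ∈ R}` to within the factor `1 + 1/kη` for all but a `1/kδ` fraction of the
coin strings `u ∈ {0,1}^{c(|x|+m+kη+kδ)}` — as the theorem `StockMachine.stockmeyerApproxCounting_holds`.

The mathematics (pairwise-independent affine hashing, Chebyshev, the estimator and its failure bound
`uniformProb_not_isApproxCount_le`) is in `StockmeyerEstimator.lean`; the string functions are the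
bricks of `HashBricks.lean`; the transducer shape is `TruthTableFunctions.ttFn`. Here:

* **The `NP^O` language** `StockMachine.threshLang R` (`threshLang_mem_NPRel`): the query
  `⟨x', ⟨1ᵏ, 1ᶜ⟩⟩`, `x' = countQuery x m kη kδ u`, is a member iff some certificate `W` of length
  `≤ (|w| + 2)²` passes the **checker** `checker R = ttLang qryW (X + 1) evalLang R ∈ P^R ⊆ P^O`
  (`TruthTableClosure.ttLang_mem_PRel`, `CookReducibilityTransitive`): `W` lists, as a nested-pair
  list, items `y₀, …, y_c` with `⟨x, y_j⟩ ∈ R` (the oracle bits), `|y_j| = m`, `y_j` hashing to `0`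
  at level `k` under the coin hash (`hzLang`: a bounded quantifier over the rows `j' < k`, each row an
  `𝔽₂` inner product `andParityFn` of `u[j'(m+1) …]` with `y_j` compared with the offset bit), and
  `y_j < y_{j+1}` as numerals (`itemLang`, `evalLang`: bounded quantifier over `j ≤ c`). Semantics:
  `mem_checker_iff`, and **`mem_threshLang_iff`**: membership iff `c + 1 ≤ levelCount R m x u k`
  (⇒ the items are distinct members of the counted set; ⇐ list `c + 1` members sorted by value).
* **The counter** `StockMachine.counter R = ttFn qryF ((X+1)²) outG (threshLang R) ∈ FP^{L}`
  (`counter_mem_FPRel`): with `T = |x'| + 1` it asks the `T²` questions `(k, c) = (i / T, i mod T)`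
  (`qryF`, by `Plumb.divModFn`) and scans the answer blocks (`outG = scanFn mStrF popCountFn`);
  `blk_ttBits`: block `k` is `[c + 1 ≤ Y_k]_{c<T}`, so it has a `0` iff `Y_k < T` and `min (Y_k, T)`
  ones; **`countEstimate_counter`**: the answer read as a number is
  `Stockmeyer.estimate m T (levelCount R m x u)`.
* **`stockmeyerApproxCounting_holds`**: with the coin budget `coinPoly = 24 n³ + n² + n` one has
  `T > |u| = coinPoly (|x|+m+kη+kδ) ≥ 24 kη² kδ` and `|u| ≥ m (m + 1)`, so
  `StockmeyerEstimator.uniformProb_not_isApproxCount_le` applies (`uniformProb_congr` moves between the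
  two descriptions of the event on strings of the sampled length).

## References

* S. Aaronson, A. Arkhipov, *The computational complexity of linear optics*, Theory of Computing 9
  (2013) 143–252, Thm. 4.1 (p. 175) and Def. 2.4 (p. 163); after L. J. Stockmeyer, *On approximation
  algorithms for #P*, SIAM J. Comput. 14 (1985) 849–861.
* S. Arora, B. Barak, *Computational Complexity: A Modern Approach*, CUP 2009, §3.4 (oracle
  machines), Def. 2.1 (certificates), §1.3.
* R. E. Ladner, N. A. Lynch, A. L. Selman, *A comparison of polynomial time reducibilities*,
  Theoret. Comput. Sci. 1 (1975) 103–123, §2–3.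
-/

namespace Literature.Computability.Complexity

open _root_.Computability Polynomial Brick Plumb OracleCompose HashBricks Stockmeyer Finset

namespace StockMachine

/-! ### Parsers

The approximate counter's oracle query is `w = ⟨x', ⟨1ᵏ, 1ᶜ⟩⟩` with the counting query
`x' = ⟨⟨x, ⟨1ᵐ, ⟨1^{kη}, 1^{kδ}⟩⟩⟩, u⟩` (`countQuery`); the witness checker reads
`a' = ⟨⟨⟨w, W⟩, bits⟩, 1ʲ⟩` (the certificate `W`, the oracle answer bits of the truth-table
machine, the index `j` of the bounded quantifier). All parsers are total (`boolUnpair`). -/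

/-- `1ʲ` of `a' = ⟨v, 1ʲ⟩`. [folklore] -/
def jS : List Bool → List Bool := sndF
/-- `z = ⟨w, W⟩` of `a' = ⟨⟨z, bits⟩, 1ʲ⟩`. [folklore] -/
def zS : List Bool → List Bool := fstF ∘ fstF
/-- The answer bits of `a'`. [folklore] -/
def bitsS : List Bool → List Bool := sndF ∘ fstF
/-- The query `w` of `a'`. [folklore] -/
def wS : List Bool → List Bool := fstF ∘ zS
/-- The certificate `W` of `a'`. [folklore] -/
def WS : List Bool → List Bool := sndF ∘ zS
/-- The counting query `x'` of `a'`. [folklore] -/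
def xpS : List Bool → List Bool := fstF ∘ wS
/-- `1ᵏ` (the level) of `a'`. [folklore] -/
def kS : List Bool → List Bool := fstF ∘ sndF ∘ wS
/-- `1ᶜ` (the threshold, less one) of `a'`. [folklore] -/
def cS : List Bool → List Bool := sndF ∘ sndF ∘ wS
/-- The coins `u` of `a'`. [folklore] -/
def uS : List Bool → List Bool := sndF ∘ xpS
/-- The instance `x` of `a'`. [folklore] -/
def xS : List Bool → List Bool := fstF ∘ fstF ∘ xpS
/-- `1ᵐ` (the witness length) of `a'`. [folklore] -/
def mS : List Bool → List Bool := fstF ∘ sndF ∘ fstF ∘ xpS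
/-- The `j`-th certificate item `y_j` of `a'`. [folklore] -/
noncomputable def yS : List Bool → List Bool := nthItemFn ∘ fanoutFn jS WS
/-- The next certificate item `y_{j+1}` of `a'`. [folklore] -/
noncomputable def y1S : List Bool → List Bool := nthItemFn ∘ fanoutFn (List.cons true ∘ jS) WS

/-- All parsers are in `FP`. [folklore] -/
theorem parsers_mem_FP :
    jS ∈ FP ∧ zS ∈ FP ∧ bitsS ∈ FP ∧ wS ∈ FP ∧ WS ∈ FP ∧ xpS ∈ FP ∧ kS ∈ FP ∧ cS ∈ FP ∧ uS ∈ FP ∧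
      xS ∈ FP ∧ mS ∈ FP ∧ yS ∈ FP ∧ y1S ∈ FP := by
  have hz : zS ∈ FP := comp_mem_FP fstF_mem_FP fstF_mem_FP
  have hw : wS ∈ FP := comp_mem_FP fstF_mem_FP hz
  have hW : WS ∈ FP := comp_mem_FP sndF_mem_FP hz
  have hxp : xpS ∈ FP := comp_mem_FP fstF_mem_FP hw
  refine ⟨sndF_mem_FP, hz, comp_mem_FP sndF_mem_FP fstF_mem_FP, hw, hW, hxp,
    comp_mem_FP fstF_mem_FP (comp_mem_FP sndF_mem_FP hw), comp_mem_FP sndF_mem_FP (comp_mem_FP sndF_mem_FP hw),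
    comp_mem_FP sndF_mem_FP hxp, comp_mem_FP fstF_mem_FP (comp_mem_FP fstF_mem_FP hxp),
    comp_mem_FP fstF_mem_FP (comp_mem_FP sndF_mem_FP (comp_mem_FP fstF_mem_FP hxp)),
    comp_mem_FP nthItemFn_mem_FP (fanoutFn_mem_FP sndF_mem_FP hW),
    comp_mem_FP nthItemFn_mem_FP (fanoutFn_mem_FP (comp_mem_FP (cons_mem_FP true) sndF_mem_FP) hW)⟩

/-! ### The hash-row test (inner bounded quantifier over rows `j' < k`)

On `b' = ⟨a', 1^{j'}⟩`: accept iff `k ≤ j'` or row `j'` of the coin hash sends `y_j` to `0`, i.e.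
the `𝔽₂` inner product of `u[j'(m+1) …]` with `y_j` equals the offset bit `u[j'(m+1) + m]`. -/

/-- `1^{j'(m+1)}`: the offset of hash row `j'` in the coins. [folklore] -/
noncomputable def sB : List Bool → List Bool := umulFn ∘ fanoutFn sndF (List.cons true ∘ mS ∘ fstF)
/-- The coins from row `j'` on. [folklore] -/
noncomputable def rowB : List Bool → List Bool := dropFn ∘ fanoutFn sB (uS ∘ fstF)
/-- The inner-product bit of row `j'` with `y_j`. [folklore] -/
noncomputable def dotB : List Bool → List Bool := andParityFn ∘ fanoutFn rowB (yS ∘ fstF)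
/-- The offset bit of row `j'`. [folklore] -/
noncomputable def offB : List Bool → List Bool :=
  headBitFn ∘ dropFn ∘ fanoutFn (concatFn ∘ fanoutFn sB (mS ∘ fstF)) (uS ∘ fstF)

/-- **The row language**: `k ≤ j'`, or row `j'` hashes `y_j` to `0`. [folklore] -/
noncomputable def rowLang : Language Bool :=
  (fanoutFn sndF (kS ∘ fstF) ⁻¹' LenLe X) ⊔ {b' | dotB b' = offB b'}

/-- `rowLang ∈ P`. [folklore] -/
theorem rowLang_mem_P : rowLang ∈ Classes.P := by
  obtain ⟨-, -, -, -, -, -, hk, -, hu, -, hm, hy, -⟩ := parsers_mem_FP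
  have hs : sB ∈ FP := comp_mem_FP umulFn_mem_FP (fanoutFn_mem_FP sndF_mem_FP
    (comp_mem_FP (cons_mem_FP true) (comp_mem_FP hm fstF_mem_FP)))
  have hrow : rowB ∈ FP := comp_mem_FP dropFn_mem_FP (fanoutFn_mem_FP hs (comp_mem_FP hu fstF_mem_FP))
  have hdot : dotB ∈ FP := comp_mem_FP andParityFn_mem_FP (fanoutFn_mem_FP hrow (comp_mem_FP hy fstF_mem_FP))
  have hoff : offB ∈ FP := comp_mem_FP headBitFn_mem_FP (comp_mem_FP dropFn_mem_FP (fanoutFn_mem_FP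
    (comp_mem_FP concatFn_mem_FP (fanoutFn_mem_FP hs (comp_mem_FP hm fstF_mem_FP))) (comp_mem_FP hu fstF_mem_FP)))
  exact union_mem_P (preimage_mem_P (LenLe_mem_P X) (fanoutFn_mem_FP sndF_mem_FP (comp_mem_FP hk fstF_mem_FP)))
    (setOf_apply_eq_apply_mem_P hdot hoff)

/-- **The hash test** `HashesToZero u m k y_j` as a bounded quantifier over the rows.
[folklore] -/
noncomputable def hzLang : Language Bool := ballLang (X + 1) rowLang

/-- `hzLang ∈ P`. [folklore] -/
theorem hzLang_mem_P : hzLang ∈ Classes.P := ballLang_mem_P _ rowLang_mem_P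

/-! ### The item test (outer bounded quantifier over items `j ≤ c`) -/

/-- **The item language**: on `a' = ⟨⟨z, bits⟩, 1ʲ⟩`, accept iff `c < j`, or: the `j`-th answer bit
is `1` (i.e. `⟨x, y_j⟩ ∈ R`), `|y_j| = m`, `y_j` hashes to zero at level `k`, and (`j = c` or
`y_j < y_{j+1}` as numerals). [folklore] -/
noncomputable def itemLang : Language Bool :=
  (fanoutFn jS cS ⁻¹' LenLt X) ⊔
    (({a' | (bitAtFn ∘ fanoutFn jS bitsS) a' = [true]} ⊓ (fanoutFn mS yS ⁻¹' LenEq X) ⊓ hzLang) ⊓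
      ({a' | jS a' = cS a'} ⊔ {a' | (ltFn ∘ fanoutFn yS y1S) a' = [true]}))

/-- `itemLang ∈ P`. [folklore] -/
theorem itemLang_mem_P : itemLang ∈ Classes.P := by
  obtain ⟨hj, -, hbits, -, -, -, -, hc, -, -, hm, hy, hy1⟩ := parsers_mem_FP
  refine union_mem_P (preimage_mem_P (LenLt_mem_P X) (fanoutFn_mem_FP hj hc)) (inter_mem_P
    (inter_mem_P (inter_mem_P (setOf_apply_eq_apply_mem_P (comp_mem_FP bitAtFn_mem_FP (fanoutFn_mem_FP hj hbits))
      (const_mem_FP _)) (preimage_mem_P (LenEq_mem_P X) (fanoutFn_mem_FP hm hy))) hzLang_mem_P)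
    (union_mem_P (setOf_apply_eq_apply_mem_P hj hc)
      (setOf_apply_eq_apply_mem_P (comp_mem_FP ltFn_mem_FP (fanoutFn_mem_FP hy hy1)) (const_mem_FP _))))

/-- **The evaluator** of the witness checker: all items `j < |v| + 1` pass the item test. [folklore] -/
noncomputable def evalLang : Language Bool := ballLang (X + 1) itemLang

/-- `evalLang ∈ P`. [folklore] -/
theorem evalLang_mem_P : evalLang ∈ Classes.P := ballLang_mem_P _ itemLang_mem_P

/-- **The query generator** of the witness checker: on `⟨z, 1ʲ⟩`, `z = ⟨⟨x', ⟨1ᵏ, 1ᶜ⟩⟩, W⟩`, the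
query `⟨x, y_j⟩` to the relation `R`. [folklore] -/
noncomputable def qryW : List Bool → List Bool :=
  fanoutFn (fstF ∘ fstF ∘ fstF ∘ fstF ∘ fstF) (nthItemFn ∘ fanoutFn sndF (sndF ∘ fstF))

/-- `qryW ∈ FP`. [folklore] -/
theorem qryW_mem_FP : qryW ∈ FP :=
  fanoutFn_mem_FP (comp_mem_FP fstF_mem_FP (comp_mem_FP fstF_mem_FP (comp_mem_FP fstF_mem_FP
    (comp_mem_FP fstF_mem_FP fstF_mem_FP))))
    (comp_mem_FP nthItemFn_mem_FP (fanoutFn_mem_FP sndF_mem_FP (comp_mem_FP sndF_mem_FP fstF_mem_FP)))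

/-- **The witness checker** `R'`: the language truth-table reduced to `R` by `qryW` and `evalLang` —
`⟨w, W⟩ ∈ R'` iff `W` lists `c + 1` strictly increasing `R`-witnesses of length `m` hashing to zero
at level `k` (semantics in the sequel). [folklore] -/
noncomputable def checker (R : Language Bool) : Language Bool := ttLang qryW (X + 1) evalLang R

/-- **`R' ∈ P^O` whenever `R ∈ P^O`** (`P^R ⊆ P^{P^O} = P^O`, `CookReducibilityTransitive.lean`).
[Ladner–Lynch–Selman 1975, §2–3] [folklore] -/
theorem checker_mem_PRel {O : Oracle} {R : Language Bool} (hR : R ∈ PRel O) : checker R ∈ PRel O :=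
  mem_PRel_of_polyTimeTuringReducible_holds (ttLang_mem_PRel qryW_mem_FP evalLang_mem_P R) hR

/-- The certificate-length polynomial `(n + 2)²`. [folklore] -/
noncomputable def certPoly : Polynomial ℕ := (X + 2) ^ 2

/-- **The threshold language** `L_st`: `w = ⟨x', ⟨1ᵏ, 1ᶜ⟩⟩ ∈ L_st` iff some certificate of length
`≤ (|w| + 2)²` passes the checker — iff at least `c + 1` witnesses `y ∈ {0,1}^m` of `x` hash to
zero at level `k` (semantics in the sequel). [cite: AaronsonArkhipovToC2013, Thm. 4.1 (p. 175)] -/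
def threshLang (R : Language Bool) : Language Bool :=
  {w | ∃ W : List Bool, W.length ≤ certPoly.eval w.length ∧ boolPair w W ∈ checker R}

/-- **`L_st ∈ NP^O` whenever `R ∈ P^O`** (`NP^O = ∃·P^O`). [folklore] -/
theorem threshLang_mem_NPRel {O : Oracle} {R : Language Bool} (hR : R ∈ PRel O) :
    threshLang R ∈ NPRel O :=
  ⟨checker R, checker_mem_PRel hR, certPoly, fun _ => Iff.rfl⟩

/-! ### Formats and parsing lemmas -/

/-- The approximate counter's oracle query `⟨x', ⟨1ᵏ, 1ᶜ⟩⟩`: "are there at least `c + 1` witnesses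
hashing to zero at level `k`?". [folklore] -/
def qry (x' : List Bool) (k c : ℕ) : List Bool := boolPair x' (boolPair (ones k) (ones c))

/-- The argument `⟨⟨⟨w, W⟩, bits⟩, 1ʲ⟩` of the item test. [folklore] -/
def argA (w W bits : List Bool) (j : ℕ) : List Bool := boolPair (boolPair (boolPair w W) bits) (ones j)

/-- The `j`-th item of a certificate. [folklore] -/
noncomputable def item (W : List Bool) (j : ℕ) : List Bool := nthItemFn (boolPair (ones j) W)

/-- Membership in a union of languages. [folklore] -/
theorem memL_sup {L₁ L₂ : Language Bool} {w : List Bool} : w ∈ L₁ ⊔ L₂ ↔ w ∈ L₁ ∨ w ∈ L₂ := Iff.rfl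

/-- Membership in an intersection of languages. [folklore] -/
theorem memL_inf {L₁ L₂ : Language Bool} {w : List Bool} : w ∈ L₁ ⊓ L₂ ↔ w ∈ L₁ ∧ w ∈ L₂ := Iff.rfl

/-- Membership in a `setOf` language. [folklore] -/
theorem memL_setOf {p : List Bool → Prop} {w : List Bool} : @Membership.mem (List Bool) (Language Bool) _ {v | p v} w ↔ p w :=
  Iff.rfl

section Parse

variable (x : List Bool) (m kη kδ : ℕ) (u : List Bool) (k c : ℕ) (W bits : List Bool) (j : ℕ)

/-- **Parsing the item-test argument.** [folklore] -/
theorem parse_argA :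
    jS (argA (qry (countQuery x m kη kδ u) k c) W bits j) = ones j ∧
    cS (argA (qry (countQuery x m kη kδ u) k c) W bits j) = ones c ∧
    kS (argA (qry (countQuery x m kη kδ u) k c) W bits j) = ones k ∧
    uS (argA (qry (countQuery x m kη kδ u) k c) W bits j) = u ∧
    xS (argA (qry (countQuery x m kη kδ u) k c) W bits j) = x ∧
    mS (argA (qry (countQuery x m kη kδ u) k c) W bits j) = ones m ∧
    WS (argA (qry (countQuery x m kη kδ u) k c) W bits j) = W ∧
    bitsS (argA (qry (countQuery x m kη kδ u) k c) W bits j) = bits ∧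
    yS (argA (qry (countQuery x m kη kδ u) k c) W bits j) = item W j ∧
    y1S (argA (qry (countQuery x m kη kδ u) k c) W bits j) = item W (j + 1) := by
  simp [argA, qry, countQuery, jS, cS, kS, uS, xS, mS, WS, bitsS, yS, y1S, zS, wS, xpS, item,
    unaryEncodeNat_eq_replicate, ones, List.replicate_succ]

/-- The argument is at least `k` long. [folklore] -/
theorem le_length_argA : k ≤ (argA (qry (countQuery x m kη kδ u) k c) W bits j).length := by
  simp only [argA, qry, length_boolPair, ones, List.length_replicate]; omega

/-- The coins from position `n` start with bit `n`. [folklore] -/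
theorem headD_drop (l : List Bool) (n : ℕ) : (l.drop n).headD false = coinBit l n := by
  rw [coinBit, List.getD_eq_getElem?_getD, List.headD_eq_head?_getD, List.head?_drop]

variable (j' : ℕ)

/-- **Semantics of the row test.** [folklore] -/
theorem mem_rowLang_iff :
    boolPair (argA (qry (countQuery x m kη kδ u) k c) W bits j) (ones j') ∈ rowLang ↔
      k ≤ j' ∨ rowParity u m (item W j) j' = false := by
  obtain ⟨-, -, hk, hu, -, hm, -, -, hy, -⟩ := parse_argA x m kη kδ u k c W bits j
  set a := argA (qry (countQuery x m kη kδ u) k c) W bits j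
  have hs : sB (boolPair a (ones j')) = ones (j' * (m + 1)) := by
    rw [sB, Function.comp_apply, fanoutFn_apply, sndF_boolPair, Function.comp_apply, Function.comp_apply,
      fstF_boolPair, hm, show true :: ones m = ones (m + 1) by simp [ones, List.replicate_succ], umulFn_boolPair]
  have hdot : dotB (boolPair a (ones j')) =
      [decide (Odd (((u.drop (j' * (m + 1))).zipWith (· && ·) (item W j)).count true))] := by
    rw [dotB, Function.comp_apply, fanoutFn_apply, rowB, Function.comp_apply, fanoutFn_apply, hs,
      Function.comp_apply, fstF_boolPair, hu, dropFn_boolPair, Function.comp_apply, fstF_boolPair, hy,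
      andParityFn_boolPair, ones, List.length_replicate]
  have hoff : offB (boolPair a (ones j')) = [coinBit u (j' * (m + 1) + m)] := by
    rw [offB, Function.comp_apply, Function.comp_apply, fanoutFn_apply, Function.comp_apply, fanoutFn_apply, hs,
      Function.comp_apply, fstF_boolPair, hm, concatFn_boolPair, Function.comp_apply, fstF_boolPair, hu,
      dropFn_boolPair, headBitFn_apply, headD_drop]
    simp [ones]
  rw [rowLang, memL_sup, memL_preimage, fanoutFn_apply, sndF_boolPair, Function.comp_apply, fstF_boolPair, hk,
    boolPair_mem_LenLe, memL_setOf, hdot, hoff, rowParity, rowStart]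
  simp only [ones, List.length_replicate, eval_X, List.cons.injEq, and_true]
  constructor
  · rintro (h | h)
    · exact Or.inl h
    · exact Or.inr (by rw [h]; simp)
  · rintro (h | h)
    · exact Or.inl h
    · refine Or.inr ?_
      revert h
      cases decide (Odd (List.count true (List.zipWith (fun x1 x2 => x1 && x2) (List.drop (j' * (m + 1)) u) (item W j))))
        <;> cases coinBit u (j' * (m + 1) + m) <;> simp

/-- **Semantics of the hash test**: `y_j` hashes to zero at level `k`. [folklore] -/
theorem mem_hzLang_iff :
    argA (qry (countQuery x m kη kδ u) k c) W bits j ∈ hzLang ↔ HashesToZero u m k (item W j) := by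
  have hk := le_length_argA x m kη kδ u k c W bits j
  rw [hzLang, mem_ballLang]
  simp only [eval_add, eval_X, eval_one, ← ones.eq_1]
  constructor
  · intro h i hi
    have := (mem_rowLang_iff x m kη kδ u k c W bits j i).1 (by simpa [ones] using h i (by omega))
    exact this.resolve_left (by omega)
  · intro h i hi
    have := (mem_rowLang_iff x m kη kδ u k c W bits j i).2
      (if hki : k ≤ i then Or.inl hki else Or.inr (h i (by omega)))
    simpa [ones] using this

/-- **Semantics of the item test.** [folklore] -/
theorem mem_itemLang_iff :
    argA (qry (countQuery x m kη kδ u) k c) W bits j ∈ itemLang ↔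
      c < j ∨ ((bits.drop j).take 1 = [true] ∧ (item W j).length = m ∧ HashesToZero u m k (item W j) ∧
        (j = c ∨ bitsToNat (item W j) < bitsToNat (item W (j + 1)))) := by
  obtain ⟨hj, hc, -, -, -, hm, -, hbits, hy, hy1⟩ := parse_argA x m kη kδ u k c W bits j
  have hz := mem_hzLang_iff x m kη kδ u k c W bits j
  set a := argA (qry (countQuery x m kη kδ u) k c) W bits j
  rw [itemLang, memL_sup, memL_inf, memL_inf, memL_inf, memL_sup, memL_preimage, memL_preimage, memL_setOf,
    memL_setOf, memL_setOf, fanoutFn_apply, hj, hc, boolPair_mem_LenLt, Function.comp_apply, fanoutFn_apply, hj,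
    hbits, bitAtFn_boolPair, fanoutFn_apply, hm, hy, boolPair_mem_LenEq, hz, Function.comp_apply, fanoutFn_apply,
    hy, hy1, ltFn_boolPair]
  simp only [ones, List.length_replicate, eval_X, List.cons.injEq, and_true, decide_eq_true_eq]
  have hrep : List.replicate j true = List.replicate c true ↔ j = c :=
    ⟨fun h => by simpa using congrArg List.length h, fun h => by rw [h]⟩
  rw [hrep]
  simp only [and_assoc]

end Parse

/-! ### Semantics of the checker -/

section Checker

variable (R : Language Bool) (x : List Bool) (m kη kδ : ℕ) (u : List Bool) (k c : ℕ) (W : List Bool)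

/-- The checker's query at index `j` is `⟨x, y_j⟩`. [folklore] -/
theorem qryW_apply (j : ℕ) :
    qryW (boolPair (boolPair (qry (countQuery x m kη kδ u) k c) W) (ones j)) = boolPair x (item W j) := by
  simp [qryW, qry, countQuery, item, ones]

/-- **Semantics of the checker**: the certificate lists, at positions `0, …, c`, `R`-witnesses of `x`
of length `m` hashing to zero at level `k`, strictly increasing as numerals. [folklore] -/
theorem mem_checker_iff :
    boolPair (qry (countQuery x m kη kδ u) k c) W ∈ checker R ↔
      ∀ j ≤ c, boolPair x (item W j) ∈ R ∧ (item W j).length = m ∧ HashesToZero u m k (item W j) ∧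
        (j = c ∨ bitsToNat (item W j) < bitsToNat (item W (j + 1))) := by
  set z := boolPair (qry (countQuery x m kη kδ u) k c) W with hz
  have hcz : c ≤ z.length := by
    simp only [hz, qry, length_boolPair, ones, List.length_replicate]; omega
  rw [checker, mem_ttLang_iff, evalLang, mem_ballLang]
  simp only [eval_add, eval_X, eval_one, length_boolPair, length_ttBits]
  have hbit : ∀ j < z.length + 1,
      ((ttBits qryW R z (z.length + 1)).drop j).take 1 = [true] ↔ boolPair x (item W j) ∈ R := by
    intro j hj
    rw [List.take_one_drop_eq_of_lt_length (by simpa using hj), List.get_eq_getElem, List.cons.injEq,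
      getElem_ttBits_eq_true_iff]
    simp only [and_true, ← ones.eq_1]
    rw [show qryW (boolPair z (ones j)) = boolPair x (item W j) from by rw [hz]; exact qryW_apply x m kη kδ u k c W j]
  constructor
  · intro h j hj
    have h1 := (mem_itemLang_iff x m kη kδ u k c W _ j).1 (h j (by omega))
    rcases h1 with h1 | ⟨hb, hlen, hhz, hlt⟩
    · omega
    · exact ⟨(hbit j (by omega)).1 hb, hlen, hhz, hlt⟩
  · intro h j hj
    refine (mem_itemLang_iff x m kη kδ u k c W _ j).2 ?_
    by_cases hjc : c < j
    · exact Or.inl hjc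
    · obtain ⟨hR, hlen, hhz, hlt⟩ := h j (by omega)
      exact Or.inr ⟨(hbit j (by omega)).2 hR, hlen, hhz, hlt⟩

end Checker

/-! ### Semantics of the threshold language: counting witnesses -/

section Thresh

variable (R : Language Bool) (x : List Bool) (m kη kδ : ℕ) (u : List Bool) (k c : ℕ)

/-- The length of a coded list. [folklore] -/
theorem length_body (l : List (List Bool)) : (body l).length = (l.map fun a => 2 * a.length + 2).sum := by
  induction l with
  | nil => rfl
  | cons a l ih => rw [body_cons, length_boolPair, ih, List.map_cons, List.sum_cons, Nat.add_comm]

/-- Items of a coded list. [folklore] -/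
theorem item_body (l : List (List Bool)) (j : ℕ) : item (body l) j = l.getD j [] := nthItemFn_body j l

/-- The length of the threshold query. [folklore] -/
theorem length_qry_countQuery :
    c + 2 * m + 2 ≤ (qry (countQuery x m kη kδ u) k c).length := by
  simp only [qry, countQuery, length_boolPair, ones, List.length_replicate, unaryEncodeNat_eq_replicate]
  omega

/-- Consecutive strict increase chains. [folklore] -/
theorem lt_of_chain {f : ℕ → ℕ} {c : ℕ} (h : ∀ j < c, f j < f (j + 1)) :
    ∀ j ≤ c, ∀ i < j, f i < f j
  | 0, _, i, hi => absurd hi (Nat.not_lt_zero _)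
  | j + 1, hj, i, hi => by
    rcases Nat.lt_succ_iff_lt_or_eq.1 hi with hi | rfl
    · exact (lt_of_chain h j (by omega) i hi).trans (h j (by omega))
    · exact h i (by omega)

/-- `bitsToNat` is injective on vectors of a fixed length. [folklore] -/
theorem bitsToNat_toList_injective : Function.Injective fun y : List.Vector Bool m => bitsToNat y.toList := by
  intro y y' h
  apply List.Vector.toList_injective
  exact Kannan.eq_of_bitsToNat_eq (by simp) h

/-- **Semantics of the threshold language**: on the query `⟨x', ⟨1ᵏ, 1ᶜ⟩⟩`,
`x' = countQuery x m kη kδ u`, membership holds iff at least `c + 1` witnesses `y ∈ {0,1}^m` of `x`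
hash to zero at level `k` (`Stockmeyer.levelCount`). (⇒: the certificate's items are distinct members
of the counted set; ⇐: list `c + 1` members in increasing numeral order.) [cite: AaronsonArkhipovToC2013, Thm. 4.1 (p. 175)] -/
theorem mem_threshLang_iff :
    qry (countQuery x m kη kδ u) k c ∈ threshLang R ↔ c + 1 ≤ levelCount R m x u k := by
  classical
  set G : Finset (List.Vector Bool m) :=
    univ.filter fun y => boolPair x y.toList ∈ R ∧ HashesToZero u m k y.toList with hGdef
  have hG : levelCount R m x u k = G.card := by
    rw [levelCount]
  rw [hG]
  constructor
  · rintro ⟨W, -, hW⟩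
    rw [mem_checker_iff] at hW
    have hlen : ∀ j ≤ c, (item W j).length = m := fun j hj => (hW j hj).2.1
    let v : ℕ → List.Vector Bool m := fun j =>
      if h : j ≤ c then ⟨item W j, hlen j h⟩ else ⟨List.replicate m false, by simp⟩
    have hv : ∀ j ≤ c, (v j).toList = item W j := fun j hj => by simp [v, hj]
    have hmem : ∀ j ≤ c, v j ∈ G := fun j hj => by
      rw [hGdef, mem_filter, hv j hj]
      exact ⟨mem_univ _, (hW j hj).1, (hW j hj).2.2.1⟩
    have hchain : ∀ j < c, bitsToNat (item W j) < bitsToNat (item W (j + 1)) := fun j hj =>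
      ((hW j hj.le).2.2.2).resolve_left (by omega)
    have hlt := lt_of_chain hchain
    have hinj : Set.InjOn v ↑(range (c + 1)) := by
      intro i hi j hj hij
      simp only [coe_range, Set.mem_Iio] at hi hj
      by_contra hne
      have key : bitsToNat (v i).toList = bitsToNat (v j).toList := by rw [hij]
      rw [hv i (by omega), hv j (by omega)] at key
      rcases lt_or_gt_of_ne hne with h | h
      · exact absurd key (ne_of_lt (hlt j (by omega) i h))
      · exact absurd key (ne_of_gt (hlt i (by omega) j h))
    calc c + 1 = (range (c + 1)).card := (card_range _).symm
      _ = ((range (c + 1)).image v).card := (card_image_of_injOn hinj).symm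
      _ ≤ G.card := card_le_card (fun y hy => by
          obtain ⟨j, hj, rfl⟩ := mem_image.1 hy
          exact hmem j (by have := mem_range.1 hj; omega))
  · intro hc
    set f : List.Vector Bool m → ℕ := fun y => bitsToNat y.toList with hfdef
    have hf : Function.Injective f := bitsToNat_toList_injective m
    set ns : List ℕ := (G.image f).sort with hnsdef
    have hns_len : ns.length = G.card := by
      rw [hnsdef, length_sort, card_image_of_injective _ hf]
    have hsorted : ns.SortedLT := sortedLT_sort _
    have hmem : ∀ j < ns.length, ∃ y ∈ G, f y = ns[j]! := by
      intro j hj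
      have : ns[j]! ∈ G.image f := by
        rw [← mem_sort (· ≤ ·), ← hnsdef, List.getElem!_eq_getElem?_getD, List.getElem?_eq_getElem hj]
        exact List.getElem_mem hj
      simpa only [mem_image] using this
    choose! g hgG hgf using hmem
    -- the certificate
    set l : List (List Bool) := (List.range (c + 1)).map fun j => (g j).toList with hldef
    refine ⟨body l, ?_, ?_⟩
    · -- length
      rw [length_body, certPoly, eval_pow, eval_add, eval_X, eval_ofNat]
      have hsum : (l.map fun a => 2 * a.length + 2).sum = (c + 1) * (2 * m + 2) := by
        rw [hldef, List.map_map]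
        have : ((fun a : List Bool => 2 * a.length + 2) ∘ fun j => (g j).toList) = fun _ => 2 * m + 2 := by
          funext j; simp
        rw [this, List.map_const', List.sum_replicate, List.length_range, smul_eq_mul]
      rw [hsum]
      have hL := length_qry_countQuery x m kη kδ u k c
      calc (c + 1) * (2 * m + 2) ≤ ((qry (countQuery x m kη kδ u) k c).length + 2) *
            ((qry (countQuery x m kη kδ u) k c).length + 2) := Nat.mul_le_mul (by omega) (by omega)
        _ = _ := by ring
    · rw [mem_checker_iff]
      intro j hj
      have hjn : j < ns.length := by rw [hns_len]; omega
      have hitem : ∀ i ≤ c, item (body l) i = (g i).toList := fun i hi => by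
        rw [item_body, hldef, List.getD_eq_getElem?_getD, List.getElem?_map,
          List.getElem?_range (by omega : i < c + 1)]
        rfl
      rw [hitem j hj]
      have hgj := hgG j hjn
      rw [hGdef, mem_filter] at hgj
      refine ⟨hgj.2.1, by simp, hgj.2.2, ?_⟩
      by_cases hjc : j = c
      · exact Or.inl hjc
      · right
        have hj1 : j + 1 < ns.length := by rw [hns_len]; omega
        rw [hitem (j + 1) (by omega)]
        change f (g j) < f (g (j + 1))
        rw [hgf j hjn, hgf (j + 1) hj1, List.getElem!_eq_getElem?_getD, List.getElem!_eq_getElem?_getD,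
          List.getElem?_eq_getElem hjn, List.getElem?_eq_getElem hj1, Option.getD_some, Option.getD_some]
        exact hsorted.getElem_lt_getElem_of_lt (Nat.lt_succ_self j)

end Thresh

/-! ### The approximate counter `F ∈ FP^{L_st}` -/

/-- `1ᵐ` read off the counting query `x' = ⟨⟨x, ⟨1ᵐ, …⟩⟩, u⟩`. [folklore] -/
def mStrF : List Bool → List Bool := fstF ∘ sndF ∘ fstF

/-- `mStrF ∈ FP`. [folklore] -/
theorem mStrF_mem_FP : mStrF ∈ FP := comp_mem_FP fstF_mem_FP (comp_mem_FP sndF_mem_FP fstF_mem_FP)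

/-- `mStrF (countQuery x m kη kδ u) = 1ᵐ`. [folklore] -/
@[simp] theorem mStrF_countQuery (x : List Bool) (m kη kδ : ℕ) (u : List Bool) :
    mStrF (countQuery x m kη kδ u) = ones m := by
  simp [mStrF, countQuery, unaryEncodeNat_eq_replicate, ones]

/-- `mStrF` shortens. [folklore] -/
theorem length_mStrF_le (w : List Bool) : (mStrF w).length ≤ w.length := by
  have h1 := length_fstF_sndF_le w
  have h2 := length_fstF_sndF_le (fstF w)
  have h3 := length_fstF_sndF_le (sndF (fstF w))
  simp only [mStrF, Function.comp_apply]
  omega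

/-- `|encodeNat n| ≤ n`. [folklore] -/
theorem length_encodeNat_le_self : ∀ n : ℕ, (encodeNat n).length ≤ n
  | 0 => by decide
  | n + 1 => (length_encodeNat_succ_le n).trans (Nat.add_le_add_right (length_encodeNat_le_self n) 1)

/-- `popCountFn` shortens. [folklore] -/
theorem length_popCountFn_le (w : List Bool) : (popCountFn w).length ≤ w.length := by
  rw [popCountFn_apply]
  exact (length_encodeNat_le_self _).trans List.count_le_length

/-- **The output map** of the counter: the block scan with `m` read off the query and counts in
binary. [folklore] -/
noncomputable def outG : List Bool → List Bool := scanFn mStrF popCountFn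

/-- `outG ∈ FP`. [folklore] -/
theorem outG_mem_FP : outG ∈ FP := scanFn_mem_FP mStrF_mem_FP popCountFn_mem_FP length_popCountFn_le

/-- **The query generator** of the counter: query `i` on `x'` is `⟨x', ⟨1^{i / T}, 1^{i mod T}⟩⟩`,
`T = |x'| + 1` (level and threshold by `Plumb.divModFn`). [folklore] -/
noncomputable def qryF : List Bool → List Bool :=
  fanoutFn fstF (divModFn ∘ fanoutFn (polyFn (X + 1) ∘ fstF) sndF)

/-- `qryF ∈ FP`. [folklore] -/
theorem qryF_mem_FP : qryF ∈ FP :=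
  fanoutFn_mem_FP fstF_mem_FP (comp_mem_FP divModFn_mem_FP
    (fanoutFn_mem_FP (comp_mem_FP (polyFn_mem_FP _) fstF_mem_FP) sndF_mem_FP))

/-- Value of the query generator. [folklore] -/
@[simp] theorem qryF_apply (x' : List Bool) (i : ℕ) :
    qryF (boolPair x' (ones i)) = qry x' (i / (x'.length + 1)) (i % (x'.length + 1)) := by
  simp [qryF, qry, divModFn_boolPair]

/-- The number of queries `(n + 1)²`. [folklore] -/
noncomputable def qPoly : Polynomial ℕ := (X + 1) ^ 2

/-- **The approximate counter** `F`: ask all `T²` threshold questions `(k, c)`, `k, c < T`, then scan.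
[cite: AaronsonArkhipovToC2013, Thm. 4.1 (p. 175)] -/
noncomputable def counter (R : Language Bool) : List Bool → List Bool := ttFn qryF qPoly outG (threshLang R)

/-- **`F ∈ FP^{L_st}`.** [folklore] -/
theorem counter_mem_FPRel (R : Language Bool) : counter R ∈ FPRel (Oracle.ofLanguage (threshLang R)) :=
  ttFn_mem_FPRel qryF_mem_FP outG_mem_FP _

/-! ### The value of the counter -/

section Value

variable (R : Language Bool) (x : List Bool) (m kη kδ : ℕ) (u : List Bool)

/-- `firstZeroBlock` characterised (cf. `Stockmeyer.findLevel_eq_some_iff`). [folklore] -/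
theorem firstZeroBlock_eq_some_iff {bits : List Bool} {T m k : ℕ} :
    firstZeroBlock bits T m = some k ↔ k ≤ m ∧ false ∈ blk bits T k ∧ ∀ j < k, false ∉ blk bits T j := by
  rw [firstZeroBlock, List.find?_range_eq_some]
  simp only [decide_eq_true_eq, List.mem_range, Bool.not_eq_true', decide_eq_false_iff_not]
  constructor
  · rintro ⟨h1, h2, h3⟩; exact ⟨by omega, h1, h3⟩
  · rintro ⟨h1, h2, h3⟩; exact ⟨h2, by omega, h3⟩

/-- `firstZeroBlock` fails iff no block has a `0`. [folklore] -/
theorem firstZeroBlock_eq_none_iff {bits : List Bool} {T m : ℕ} :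
    firstZeroBlock bits T m = none ↔ ∀ k ≤ m, false ∉ blk bits T k := by
  rw [firstZeroBlock, List.find?_range_eq_none]
  simp only [Bool.not_eq_true', decide_eq_false_iff_not]
  exact ⟨fun h k hk => h k (by omega), fun h k hk => h k (by omega)⟩

/-- Counting `true`s in a mapped range. [folklore] -/
theorem count_map_range (f : ℕ → Bool) : ∀ T : ℕ,
    ((List.range T).map f).count true = ((Finset.range T).filter fun c => f c = true).card
  | 0 => by simp
  | T + 1 => by
    rw [List.range_succ, List.map_append, List.count_append, count_map_range f T, Finset.range_add_one,
      Finset.filter_insert]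
    by_cases h : f T = true
    · rw [if_pos h, card_insert_of_notMem (by simp)]; simp [h]
    · rw [if_neg h]; simp [Bool.eq_false_iff.2 h]

/-- `#{c < T | c + 1 ≤ Y} = min Y T`. [folklore] -/
theorem card_filter_succ_le (Y T : ℕ) : ((Finset.range T).filter fun c => c + 1 ≤ Y).card = min Y T := by
  have : (Finset.range T).filter (fun c => c + 1 ≤ Y) = Finset.range (min Y T) := by
    ext c; simp only [mem_filter, mem_range]; omega
  rw [this, card_range]

/-- **The answer blocks of the counter**: block `k < T` lists the bits `[c + 1 ≤ Y_k]`, `c < T`.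
[folklore] -/
theorem blk_ttBits {k : ℕ} (hk : k < (countQuery x m kη kδ u).length + 1) :
    blk (ttBits qryF (threshLang R) (countQuery x m kη kδ u) (qPoly.eval (countQuery x m kη kδ u).length))
        ((countQuery x m kη kδ u).length + 1) k =
      (List.range ((countQuery x m kη kδ u).length + 1)).map fun c => decide (c + 1 ≤ levelCount R m x u k) := by
  set x' := countQuery x m kη kδ u
  set T := x'.length + 1 with hT
  have hq : qPoly.eval x'.length = T * T := by simp [qPoly, hT, sq]
  have hkT : k * T + T ≤ T * T := by nlinarith
  apply List.ext_getElem?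
  intro c
  rw [List.getElem?_map]
  by_cases hc : c < T
  · rw [List.getElem?_range hc, Option.map_some, blk, List.getElem?_take_of_lt hc, List.getElem?_drop, hq,
      ttBits, List.getElem?_map, List.getElem?_range (by nlinarith), Option.map_some, ← ones.eq_1, qryF_apply,
      ← hT]
    have h1 : (k * T + c) / T = k := by
      rw [Nat.add_comm, Nat.add_mul_div_right _ _ (by omega), Nat.div_eq_of_lt hc, Nat.zero_add]
    have h2 : (k * T + c) % T = c := by
      rw [Nat.add_comm, Nat.add_mul_mod_self_right, Nat.mod_eq_of_lt hc]
    rw [h1, h2]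
    congr 1
    by_cases hmem : qry x' k c ∈ threshLang R
    · rw [(Set.mem_iff_boolIndicator _ _).1 hmem, eq_comm, decide_eq_true_iff]
      exact (mem_threshLang_iff R x m kη kδ u k c).1 hmem
    · rw [(Set.notMem_iff_boolIndicator _ _).1 hmem, eq_comm, decide_eq_false_iff_not]
      exact fun h => hmem ((mem_threshLang_iff R x m kη kδ u k c).2 h)
  · have h1 : (List.range T)[c]? = none := List.getElem?_eq_none (by simp; omega)
    rw [h1, Option.map_none, blk, List.getElem?_eq_none]
    simp only [List.length_take]; omega

/-- A block has a `0` iff its level count is below `T`; its number of `1`s is `min (Y_k, T)`.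
[folklore] -/
theorem blk_ttBits_props {k : ℕ} (hk : k < (countQuery x m kη kδ u).length + 1) :
    (false ∈ blk (ttBits qryF (threshLang R) (countQuery x m kη kδ u)
        (qPoly.eval (countQuery x m kη kδ u).length)) ((countQuery x m kη kδ u).length + 1) k ↔
      levelCount R m x u k < (countQuery x m kη kδ u).length + 1) ∧
    (blk (ttBits qryF (threshLang R) (countQuery x m kη kδ u)
        (qPoly.eval (countQuery x m kη kδ u).length)) ((countQuery x m kη kδ u).length + 1) k).count true =
      min (levelCount R m x u k) ((countQuery x m kη kδ u).length + 1) := by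
  rw [blk_ttBits R x m kη kδ u hk]
  set T := (countQuery x m kη kδ u).length + 1
  set Y := levelCount R m x u k
  refine ⟨?_, ?_⟩
  · simp only [List.mem_map, List.mem_range, decide_eq_false_iff_not, not_le]
    constructor
    · rintro ⟨c, hc, hlt⟩; omega
    · intro h; exact ⟨Y, h, Nat.lt_succ_self _⟩
  · rw [count_map_range]
    simp only [decide_eq_true_eq]
    exact card_filter_succ_le Y T

/-- `decodeNat ε = 0`. [folklore] -/
theorem decodeNat_nil : (decodeNat [] : ℕ) = 0 := by
  simp [Computability.decodeNat, Computability.decodeNum]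

/-- `encodeNat n ≠ ε` for `n ≥ 1`. [folklore] -/
theorem encodeNat_ne_nil {n : ℕ} (hn : 0 < n) : encodeNat n ≠ [] := by
  intro h
  have := Computability.decode_encodeNat n
  rw [h, decodeNat_nil] at this
  omega

/-- `decodeNat (0ᵏ · encodeNat n) = n · 2ᵏ` for `n ≥ 1` (a canonical numeral). [folklore] -/
theorem decodeNat_replicate_append_encodeNat (k : ℕ) {n : ℕ} (hn : 0 < n) :
    decodeNat (List.replicate k false ++ encodeNat n) = n * 2 ^ k := by
  set w := List.replicate k false ++ encodeNat n with hw
  have hcanon : IsCanonicalNum w := by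
    rcases isCanonicalNum_encodeNat n with h | h
    · exact absurd h (encodeNat_ne_nil hn)
    · right
      rw [hw, List.getLast?_append, h]
      rfl
  calc decodeNat w = decodeNat (encodeNat (bitsToNat w)) := by rw [encodeNat_bitsToNat hcanon]
    _ = bitsToNat w := Computability.decode_encodeNat _
    _ = n * 2 ^ k := by
        rw [hw, bitsToNat_append, bitsToNat_replicate_false, bitsToNat_encodeNat, List.length_replicate]
        ring

end Value

section Value2

variable (R : Language Bool) (x : List Bool) (m kη kδ : ℕ) (u : List Bool)

/-- `encodeNat 0 = ε`. [folklore] -/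
theorem encodeNat_zero_eq : encodeNat 0 = [] := by decide

/-- **The counter computes Stockmeyer's estimate**: on `x' = countQuery x m kη kδ u` its answer,
read as a number, is `estimate m T (levelCount R m x u)` with `T = |x'| + 1`. [cite: AaronsonArkhipovToC2013, Thm. 4.1 (p. 175)] -/
theorem countEstimate_counter :
    countEstimate (counter R) x m kη kδ u =
      estimate m ((countQuery x m kη kδ u).length + 1) (levelCount R m x u) := by
  set x' := countQuery x m kη kδ u with hx'
  set T := x'.length + 1 with hT
  set Y := levelCount R m x u with hY
  set tb := ttBits qryF (threshLang R) x' (qPoly.eval x'.length) with htb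
  have hm : (mStrF x').length ≤ x'.length := length_mStrF_le x'
  have hmx : (mStrF x').length = m := by rw [hx', mStrF_countQuery]; simp [ones]
  have hstart : countEstimate (counter R) x m kη kδ u = decodeNat (scanFn mStrF popCountFn (boolPair x' tb)) := rfl
  rw [hstart, scanFn_apply x' tb hm, hmx]
  have hmT : m < T := by rw [← hmx]; omega
  have hmT' : m < (countQuery x m kη kδ u).length + 1 := by rw [← hx']; exact hmT
  have hprops : ∀ k ≤ m, (false ∈ blk tb T k ↔ Y k < T) ∧ (blk tb T k).count true = min (Y k) T :=
    fun k hk => blk_ttBits_props R x m kη kδ u (by omega)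
  cases hf : findLevel m T Y with
  | none =>
    have hall := findLevel_eq_none_iff.1 hf
    have hfz : firstZeroBlock tb T m = none := firstZeroBlock_eq_none_iff.2 fun k hk h => by
      have h1 := (hprops k hk).1.1 h
      have h2 := hall k hk
      omega
    rw [hfz]
    simp only [estimate, hf, decodeNat_nil]
  | some k =>
    obtain ⟨hk, hYk, hbelow⟩ := findLevel_eq_some_iff.1 hf
    have hfz : firstZeroBlock tb T m = some k :=
      firstZeroBlock_eq_some_iff.2 ⟨hk, (hprops k hk).1.2 hYk, fun j hj h => by
        have h1 := (hprops j (by omega)).1.1 h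
        have h2 := hbelow j hj
        omega⟩
    rw [hfz]
    simp only
    rw [estimate_eq_of_findLevel hf, outStr, popCountFn_apply, (hprops k hk).2, min_eq_left hYk.le]
    by_cases hY0 : Y k = 0
    · rw [hY0, encodeNat_zero_eq, if_pos rfl, decodeNat_nil, Nat.zero_mul]
    · rw [if_neg (encodeNat_ne_nil (Nat.pos_of_ne_zero hY0)),
        decodeNat_replicate_append_encodeNat k (Nat.pos_of_ne_zero hY0)]

end Value2

/-! ### Stockmeyer's theorem -/

/-- The coin polynomial `24 n³ + n² + n`: enough coins for `m ≤ n` hash rows of `m + 1` bits, and long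
enough that the threshold range `T = |x'| + 1 > |u|` exceeds `24 kη² kδ`. [folklore] -/
noncomputable def coinPoly : Polynomial ℕ := 24 * X ^ 3 + X ^ 2 + X

/-- Evaluation of `coinPoly`. [folklore] -/
theorem coinPoly_eval (n : ℕ) : coinPoly.eval n = 24 * n ^ 3 + n ^ 2 + n := by
  simp [coinPoly]

/-- The length of the counting query depends on the coins only through their number. [folklore] -/
theorem length_countQuery_eq (x : List Bool) (m kη kδ : ℕ) {u u' : List Bool} (h : u.length = u'.length) :
    (countQuery x m kη kδ u).length = (countQuery x m kη kδ u').length := by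
  simp [countQuery, length_boolPair, h]

/-- The coins are a suffix of the counting query. [folklore] -/
theorem length_le_length_countQuery (x : List Bool) (m kη kδ : ℕ) (u : List Bool) :
    u.length ≤ (countQuery x m kη kδ u).length := by
  simp [countQuery, length_boolPair]

/-- Events that agree on the strings of length `ℓ` have the same uniform probability. [folklore] -/
theorem uniformProb_congr {ℓ : ℕ} {E E' : Set (List Bool)}
    (h : ∀ u : List Bool, u.length = ℓ → (u ∈ E ↔ u ∈ E')) : uniformProb ℓ E = uniformProb ℓ E' := by
  classical
  have hf : (Finset.univ.filter fun r : List.Vector Bool ℓ => r.toList ∈ E) =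
      Finset.univ.filter fun r : List.Vector Bool ℓ => r.toList ∈ E' :=
    Finset.filter_congr fun r _ => h r.toList (by simp)
  unfold uniformProb
  rw [hf]

/-- **Stockmeyer's approximate counting theorem, relativised** — the discharge of the named fact
`stockmeyerApproxCounting` (`ApproximateCounting.lean`; Aaronson–Arkhipov 2013, Thm. 4.1, after
Stockmeyer 1985): for every oracle `O` and `R ∈ P^O` the threshold language `L_st ∈ NP^O`
(`threshLang`), the truth-table counter `F ∈ FP^{L_st}` (`counter`) and the coin budget `coinPoly`
approximate `#{y ∈ {0,1}^m | ⟨x, y⟩ ∈ R}` to within `1 + 1/kη` for all but a `1/kδ` fraction of the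
coin strings (`StockmeyerEstimator.uniformProb_not_isApproxCount_le` with `T = |x'| + 1`).
[cite: AaronsonArkhipovToC2013, Thm. 4.1 (p. 175)] -/
theorem stockmeyerApproxCounting_holds : stockmeyerApproxCounting := by
  intro O R hR
  refine ⟨threshLang R, threshLang_mem_NPRel hR, counter R, counter_mem_FPRel R, coinPoly, ?_⟩
  intro x m kη kδ hkη hkδ
  set n := x.length + m + kη + kδ with hn
  set ℓ := coinPoly.eval n with hℓ
  set T := (countQuery x m kη kδ (List.replicate ℓ false)).length + 1 with hT
  have hTu : ∀ u : List Bool, u.length = ℓ → (countQuery x m kη kδ u).length + 1 = T := fun u hu => by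
    rw [hT, length_countQuery_eq x m kη kδ (u' := List.replicate ℓ false) (by simp [hu])]
  have hev : ∀ u : List Bool, u.length = ℓ →
      (u ∈ {u | ¬ IsApproxCount kη (countWitnesses R m x) (countEstimate (counter R) x m kη kδ u)} ↔
        u ∈ {u | ¬ IsApproxCount kη (countWitnesses R m x) (estimate m T (levelCount R m x u))}) :=
    fun u hu => by simp only [Set.mem_setOf_eq, countEstimate_counter, hTu u hu]
  rw [uniformProb_congr hev]
  have hℓeq : ℓ = 24 * n ^ 3 + n ^ 2 + n := by rw [hℓ, coinPoly_eval]
  have hkηn : kη ≤ n := by omega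
  have hkδn : kδ ≤ n := by omega
  have hmn : m ≤ n := by omega
  refine uniformProb_not_isApproxCount_le R x hkη hkδ ?_ ?_
  · have h1 : ℓ ≤ (countQuery x m kη kδ (List.replicate ℓ false)).length := by
      simpa using length_le_length_countQuery x m kη kδ (List.replicate ℓ false)
    have h2 : kη ^ 2 * kδ ≤ n ^ 3 := by
      calc kη ^ 2 * kδ ≤ n ^ 2 * n := Nat.mul_le_mul (Nat.pow_le_pow_left hkηn 2) hkδn
        _ = n ^ 3 := by ring
    calc 24 * kη ^ 2 * kδ = 24 * (kη ^ 2 * kδ) := by ring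
      _ ≤ 24 * n ^ 3 := Nat.mul_le_mul_left 24 h2
      _ ≤ ℓ := by omega
      _ ≤ T := by omega
  · calc m * (m + 1) ≤ n * (n + 1) := Nat.mul_le_mul hmn (by omega)
      _ = n ^ 2 + n := by ring
      _ ≤ ℓ := by omega

end StockMachine

end Literature.Computability.Complexity
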